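import Literature.AnabelianGeometry.EtaleTheta.DoubleUnderline
import Literature.AnabelianGeometry.EtaleTheta.Thm16SubdagStatements
import Literature.AnabelianGeometry.EtaleTheta.Discharge.Sec2Prop24Reduction
import Literature.AnabelianGeometry.EtaleTheta.Discharge.Sec2Cor218iThetaSubquotients
import HarnessLib

/-!
# [EtTh] Prop. 2.4 AT THE §1 MODEL: the characteristic subgroups `Π^tp_{Y̲̲}`, `Π^tp_{Ÿ̲̲}` of `Π^tp_{X̲̲}`
# (proof-only; row W3-L2-02 / P1-b «(H1) PiYddCharacteristic at the §1 model»)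

S. Mochizuki, *The étale theta function and its Frobenioid-theoretic manifestations* [EtTh], Publ. RIMS
**45** (2009), §2, Prop. 2.4 (PRIMS PDF pp. 38–39) [cite: MochizukiEtTh2009, Prop 2.4 p.38]: "any
automorphism of the topological group `Π^tp_{X̲̲}` … induces automorphisms of `Π^tp_X`, …, `Π^tp_Ÿ`";
consumed by [IUTchII] Prop. 1.4 / 2.1 through abc-iut-L6-t1's named hypothesis (H1)
`Literature.IUT.HodgeArakelov.EtaleThetaDataOfSetting.PiYddCharacteristic C` ("every topological
automorphism of `Π^tp_{X̲̲}` stabilises `Π^tp_{Ÿ̲̲} = Π^tp_Ÿ ∩ Π^tp_{X̲̲}`", `EtaleThetaDataOfSetting.lean`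
p411758) and `BadPlaceSettingOfDoubleUnderline.YL_eq_of_piYddCharacteristic`.

Cell abc-iut, layer L2, seat abc-iut-L6-d6 (gen 3), row offered by abc-iut-L2-lead 02:25:13Z. Written
DIRECTLY OVER THE §1 MODEL (abc-iut-L2-t1's `ThetaSetting`, abc-iut-L2-t8's `EtaleThetaData.DoubleUnderline`)
— NOT over abc-iut-L2-t2's `ThetaCovers.TemperedCoverData`, whose field `isOpen_barKer` forces `G_K` finite
(finding F1, abc-iut-L2-d3 p416998) — re-using abc-iut-L2-t7's `Discharge/Sec2Prop24Reduction` (slimness ⇒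
uniqueness), abc-iut-w4-d034's squares argument (`Discharge/Sec2Prop24CharacteristicY`) at the model, and
abc-iut-L2-d1's restriction lemma `map_subgroupOf_Huu_eq_of_extends` (`Discharge/Sec2Cor218iThetaSubquotients`,
whose `rigidData_cor218_i_of_extends` derives the whole named fact `Cor218_i` from the STRONGER hypothesis
(a) "extension stabilising `Δ^tp_X` and `Π^tp_Ÿ`" + the cusp clause (b)).
PROOF-ONLY: no definition, no new named fact; every printed input that no §1 structure carries is an
EXPLICIT HYPOTHESIS (binder) of the theorem that uses it, recorded in `plan/GAP-LEDGER.md`: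

* binder `hYuu` of `map_GtpY_subgroupOf_Huu_eq_of_compactlyGenerated` — "`Π^tp_{Y̲̲}` is topologically
  generated by the compact subgroups of `Π^tp_{X̲̲}`": the `X̲̲`-reading of abc-iut-L6-d5's
  `Thm16Sub.KerToZIsCompactlyGenerated` (SUBDAG-EtTh-Thm16 row L02: print DEFINES `Π^tp_X ↠ Z` from the
  dual graph of the special fibre — one vertex, one loop for `X`, an `l`-cycle for `X̲̲` — and the universal
  graph-coverings `Y`, `Y̲̲` have TREES as dual graphs, so their tempered fundamental groups are generated by
  the (compact) decomposition groups of the irreducible components, [SemiAnbd] Thm. 3.7 (iv)); SAME gap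
  family as L02. With it the `Y̲̲`-clause holds for EVERY topological automorphism of `Π^tp_{X̲̲}`, with NO
  extension to `Π^tp_X` / `Π^tp_C` (the reverse inclusion "compact subgroups die in the discrete
  torsion-free `Z`" is PROVED: `le_GtpY_of_isCompact`);
* binder `hP24` of `map_GtpYdduu_subgroupOf_eq_of_prop24` — [EtTh] Prop. 2.4 (i) AT THE MODEL for the pair
  `Π^tp_{X̲̲} ⊆ Π^tp_X` and the `Ÿ`-member of the printed list: every topological automorphism `γ` of
  `Π^tp_{X̲̲}` extends to a topological automorphism `Γ` of `Π^tp_X` with `Γ(Π^tp_Ÿ) = Π^tp_Ÿ` (print: `C` is a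
  `K`-core, [Mzk3] Thm. 2.4; [Mzk2] Lem. 1.3.8; cusps preserved, [Mzk14] Thm. 6.5 (iii); Thm. 1.6 (i);
  Prop. 2.2 — absolute anabelian geometry, not in the tree). This binder is WEAKER than abc-iut-L2-t2's
  `TemperedCoverData.Prop24` clause (i) (extension to `Π^tp_C` stabilising seven groups).

PROVED here: (H1) from `hP24` (`map_GtpYdduu_subgroupOf_eq_of_prop24` — after unfolding, literally
`PiYddCharacteristic C`); the `Y̲̲`-clause from `hYuu` alone, and — independently — from the `Ÿ̲̲`-clause by the
squares argument (`[Π^tp_{Y̲̲} : Π^tp_{Ÿ̲̲}] = 2`, `Π^tp_{X̲̲}/Π^tp_{Y̲̲} ↪ Z` torsion-free); uniqueness of the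
extension `Γ` from temp-slimness of `Π^tp_X` (`IsSlimGroup`, [SemiAnbd] Ex. 3.10; binder `hslim`, gap
G-w4d021-3). HONEST FRAMING: [EtTh] is refereed; nothing here asserts Prop. 2.4; typed ≠ proved; no side
is taken on [IUTchIII] Cor. 3.12.
-/

noncomputable section

namespace Literature.AnabelianGeometry.EtaleTheta

open Literature.AlgebraicGeometry.Frobenioids (IsSlimGroup)
open Topology

universe u

/-! ### Folklore: subgroups, homeomorphic isomorphisms, closures -/

section Folklore

variable {G : Type u} [Group G] [TopologicalSpace G]

/-- If every `φ : G ≃ₜ* G` maps `K` into itself, every `φ` maps `K` onto itself (apply to `φ⁻¹`). [folklore] -/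
private theorem Subgroup.map_eq_of_forall_map_le (K : Subgroup G)
    (h : ∀ φ : G ≃ₜ* G, K.map φ.toMulEquiv.toMonoidHom ≤ K) (φ : G ≃ₜ* G) :
    K.map φ.toMulEquiv.toMonoidHom = K :=
  le_antisymm (h φ) fun x hx => ⟨φ.symm x, h φ.symm ⟨x, hx, rfl⟩, φ.apply_symm_apply x⟩

/-- A homeomorphic isomorphism commutes with topological closure of subgroups. [folklore] -/
private theorem Subgroup.map_topologicalClosure_eq_of_continuousMulEquiv [IsTopologicalGroup G] (H : Subgroup G)
    (φ : G ≃ₜ* G) :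
    H.topologicalClosure.map φ.toMulEquiv.toMonoidHom = (H.map φ.toMulEquiv.toMonoidHom).topologicalClosure := by
  apply SetLike.coe_injective
  change φ '' closure (H : Set G) = closure (φ '' (H : Set G))
  exact φ.toHomeomorph.image_closure (H : Set G)

end Folklore

namespace ThetaSetting

variable {p : ℕ} [Fact p.Prime] (D : ThetaSetting p)

/-! ### Compact subgroups of `Π^tp_X` lie in `Π^tp_Y` (the discreteness of `Z`) -/

/-- **Compact subgroups die in `Z`**: every compact subgroup of `Π^tp_X` lies in `Π^tp_Y = Ker(Π^tp_X ↠ Z)`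
("the discreteness of the topological group `Z`", proof of Thm. 1.6 (i) p. 24: `Π^tp_Y` is OPEN, so
`K ∩ Π^tp_Y` has finite index in the compact `K`, and `Z` is torsion-free). PROVED.
[cite: MochizukiEtTh2009, §1 p.12] -/
theorem le_GtpY_of_isCompact (K : Subgroup D.PiTemp) (hK : IsCompact (K : Set D.PiTemp)) : K ≤ D.GtpY := by
  intro k hk
  haveI : CompactSpace K := isCompact_iff_compactSpace.mp hK
  let U : Subgroup K := D.GtpY.subgroupOf K
  have hU : IsOpen (U : Set K) := D.isOpen_ker_toZ.preimage continuous_subtype_val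
  haveI : Finite (K ⧸ U) := Subgroup.quotient_finite_of_isOpen U hU
  obtain ⟨n, hn, -, hmem⟩ := U.exists_pow_mem_of_index_ne_zero Subgroup.index_ne_zero_of_finite ⟨k, hk⟩
  have hpow : D.toZ k ^ n = 1 := by
    have h1 : ((⟨k, hk⟩ ^ n : K) : D.PiTemp) ∈ D.GtpY := Subgroup.mem_subgroupOf.mp hmem
    rw [SubmonoidClass.coe_pow] at h1
    rw [← map_pow]
    exact h1
  change D.toZ k = 1
  have h2 : n • Multiplicative.toAdd (D.toZ k) = 0 := by
    rw [← toAdd_pow, hpow, toAdd_one]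
  rcases smul_eq_zero.mp h2 with h | h
  · exact absurd h hn.ne'
  · exact toAdd_eq_zero.mp h

/-- Hence the subgroup topologically generated by the compact subgroups of `Π^tp_X` lies in `Π^tp_Y` — the
inclusion `⊇` of abc-iut-L6-d5's `Thm16Sub.KerToZIsCompactlyGenerated` is a THEOREM.
[cite: MochizukiEtTh2009, §1 p.12] -/
theorem closure_compact_le_GtpY :
    (Subgroup.closure {g : D.PiTemp | ∃ C : Subgroup D.PiTemp, IsCompact (C : Set D.PiTemp) ∧ g ∈ C}).topologicalClosure ≤
      D.GtpY := by
  have hcl : IsClosed (D.GtpY : Set D.PiTemp) := Subgroup.isClosed_of_isOpen _ D.isOpen_ker_toZ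
  refine Subgroup.topologicalClosure_minimal _ ((Subgroup.closure_le _).mpr ?_) hcl
  rintro g ⟨C, hC, hg⟩
  exact D.le_GtpY_of_isCompact C hC hg

namespace EtaleThetaData.DoubleUnderline

variable {D} {E : D.EtaleThetaData} {l : ℕ} (C : E.DoubleUnderline l)

/-! ### Compact subgroups of `Π^tp_{X̲̲}` lie in `Π^tp_{Y̲̲}` -/

/-- A compact subgroup of `Π^tp_{X̲̲}` lies in `Π^tp_{Y̲̲} = Π^tp_Y ∩ Π^tp_{X̲̲}` (read inside `Π^tp_{X̲̲}`). PROVED.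
[cite: MochizukiEtTh2009, Def 2.7 p.41] -/
theorem le_GtpY_subgroupOf_Huu_of_isCompact (K : Subgroup C.Huu) (hK : IsCompact (K : Set C.Huu)) :
    K ≤ D.GtpY.subgroupOf C.Huu := by
  intro k hk
  rw [Subgroup.mem_subgroupOf]
  refine D.le_GtpY_of_isCompact (K.map C.Huu.subtype) ?_ ⟨k, hk, rfl⟩
  rw [Subgroup.coe_map]
  exact hK.image continuous_subtype_val

/-- `Π^tp_{Y̲̲}` (inside `Π^tp_{X̲̲}`) is closed: it is open. [cite: MochizukiEtTh2009, Def 2.7 p.41] -/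
theorem isClosed_GtpY_subgroupOf_Huu : IsClosed ((D.GtpY.subgroupOf C.Huu : Subgroup C.Huu) : Set C.Huu) := by
  have hopen : IsOpen ((D.GtpY.subgroupOf C.Huu : Subgroup C.Huu) : Set C.Huu) :=
    D.isOpen_ker_toZ.preimage continuous_subtype_val
  exact Subgroup.isClosed_of_isOpen _ hopen

/-- The subgroup of `Π^tp_{X̲̲}` topologically generated by its compact subgroups lies in `Π^tp_{Y̲̲}` (the
PROVED half of the binder `hYuu`). [cite: MochizukiEtTh2009, Def 2.7 p.41] -/
theorem closure_compact_le_GtpY_subgroupOf_Huu :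
    (Subgroup.closure {h : C.Huu | ∃ K : Subgroup C.Huu, IsCompact (K : Set C.Huu) ∧ h ∈ K}).topologicalClosure ≤
      D.GtpY.subgroupOf C.Huu := by
  refine Subgroup.topologicalClosure_minimal _ ((Subgroup.closure_le _).mpr ?_) C.isClosed_GtpY_subgroupOf_Huu
  rintro h ⟨K, hK, hh⟩
  exact C.le_GtpY_subgroupOf_Huu_of_isCompact K hK hh

/-- The generating set "elements of compact subgroups of `Π^tp_{X̲̲}`" is permuted by every topological
automorphism of `Π^tp_{X̲̲}`. [folklore] -/
private theorem image_compactGenerators_eq (γ : C.Huu ≃ₜ* C.Huu) :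
    γ.toMulEquiv.toMonoidHom '' {h : C.Huu | ∃ K : Subgroup C.Huu, IsCompact (K : Set C.Huu) ∧ h ∈ K} =
      {h : C.Huu | ∃ K : Subgroup C.Huu, IsCompact (K : Set C.Huu) ∧ h ∈ K} := by
  ext y
  simp only [Set.mem_image, Set.mem_setOf_eq]
  constructor
  · rintro ⟨x, ⟨K, hK, hxK⟩, rfl⟩
    refine ⟨K.map γ.toMulEquiv.toMonoidHom, ?_, ⟨x, hxK, rfl⟩⟩
    rw [Subgroup.coe_map]
    exact hK.image γ.continuous
  · rintro ⟨K, hK, hyK⟩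
    refine ⟨γ.symm y, ⟨K.map γ.symm.toMulEquiv.toMonoidHom, ?_, ⟨y, hyK, rfl⟩⟩, γ.apply_symm_apply y⟩
    rw [Subgroup.coe_map]
    exact hK.image γ.symm.continuous

/-! ### The `Y̲̲`-clause for EVERY topological automorphism of `Π^tp_{X̲̲}`, from the definition of `Z` alone -/

/-- **The `Y̲̲`-clause of [EtTh] Prop. 2.4 at the model, for EVERY topological automorphism of `Π^tp_{X̲̲}` and
WITHOUT any extension to `Π^tp_X`:** granted that `Π^tp_{Y̲̲}` is topologically generated by the compact
subgroups of `Π^tp_{X̲̲}` (binder `hYuu`, the `X̲̲`-reading of abc-iut-L6-d5's `Thm16Sub.KerToZIsCompactlyGenerated`;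
the reverse inclusion is `closure_compact_le_GtpY_subgroupOf_Huu`), every `γ ∈ Aut(Π^tp_{X̲̲})` satisfies
`γ(Π^tp_{Y̲̲}) = Π^tp_{Y̲̲}`. [cite: MochizukiEtTh2009, Prop 2.4 p.38] -/
theorem map_GtpY_subgroupOf_Huu_eq_of_compactlyGenerated
    (hYuu : D.GtpY.subgroupOf C.Huu ≤
      (Subgroup.closure {h : C.Huu | ∃ K : Subgroup C.Huu, IsCompact (K : Set C.Huu) ∧ h ∈ K}).topologicalClosure)
    (γ : C.Huu ≃ₜ* C.Huu) :
    (D.GtpY.subgroupOf C.Huu).map γ.toMulEquiv.toMonoidHom = D.GtpY.subgroupOf C.Huu := by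
  have heq : D.GtpY.subgroupOf C.Huu =
      (Subgroup.closure {h : C.Huu | ∃ K : Subgroup C.Huu, IsCompact (K : Set C.Huu) ∧ h ∈ K}).topologicalClosure :=
    le_antisymm hYuu C.closure_compact_le_GtpY_subgroupOf_Huu
  rw [heq, Subgroup.map_topologicalClosure_eq_of_continuousMulEquiv, MonoidHom.map_closure,
    C.image_compactGenerators_eq γ]

/-- The same with `Π^tp_{Y̲̲}` written as `(Π^tp_Y ∩ Π^tp_{X̲̲}) ∩ Π^tp_{X̲̲}`. [cite: MochizukiEtTh2009, Prop 2.4 p.38] -/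
theorem map_GtpYuu_subgroupOf_eq_of_compactlyGenerated
    (hYuu : D.GtpY.subgroupOf C.Huu ≤
      (Subgroup.closure {h : C.Huu | ∃ K : Subgroup C.Huu, IsCompact (K : Set C.Huu) ∧ h ∈ K}).topologicalClosure)
    (γ : C.Huu ≃ₜ* C.Huu) :
    ((D.GtpY ⊓ C.Huu).subgroupOf C.Huu).map γ.toMulEquiv.toMonoidHom = (D.GtpY ⊓ C.Huu).subgroupOf C.Huu := by
  rw [Subgroup.inf_subgroupOf_right]
  exact C.map_GtpY_subgroupOf_Huu_eq_of_compactlyGenerated hYuu γ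

/-! ### (H1): the `Ÿ̲̲`-clause from Prop. 2.4 (i) at the model -/

/-- **(H1) `PiYddCharacteristic` at the §1 model, from [EtTh] Prop. 2.4 (i)** (binder `hP24`: every topological
automorphism of `Π^tp_{X̲̲}` extends to one of `Π^tp_X` stabilising `Π^tp_Ÿ` — absolute anabelian input, not in the
tree): every `γ ∈ Aut(Π^tp_{X̲̲})` satisfies `γ(Π^tp_{Ÿ̲̲}) = Π^tp_{Ÿ̲̲}`, `Π^tp_{Ÿ̲̲} = Π^tp_Ÿ ∩ Π^tp_{X̲̲}` read inside
`Π^tp_{X̲̲}` — after unfolding this is abc-iut-L6-t1's `EtaleThetaDataOfSetting.PiYddCharacteristic C`.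
[cite: MochizukiEtTh2009, Prop 2.4 p.38] -/
theorem map_GtpYdduu_subgroupOf_eq_of_prop24
    (hP24 : ∀ γ : C.Huu ≃ₜ* C.Huu, ∃ Γ : D.PiTemp ≃ₜ* D.PiTemp,
      (∀ h : C.Huu, (Γ h : D.PiTemp) = γ h) ∧ D.GtpYdd.map Γ.toMulEquiv.toMonoidHom = D.GtpYdd)
    (γ : C.Huu ≃ₜ* C.Huu) :
    (C.GtpYdduu.subgroupOf C.Huu).map γ.toMulEquiv.toMonoidHom = C.GtpYdduu.subgroupOf C.Huu := by
  obtain ⟨Γ, hΓ, hYdd⟩ := hP24 γ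
  rw [Subgroup.inf_subgroupOf_right]
  exact C.map_subgroupOf_Huu_eq_of_extends γ Γ hΓ _ hYdd

/-- The same with the `Ÿ`-stabilisation hypothesis on `Π^tp_{Y₂}` (under the §1 root axioms `Π^tp_Ÿ = Π^tp_{Y₂}`,
abc-iut-L6-d5's hypothesis-free `Thm16Sub.GtpYdd_eq_GtpYN_two`). [cite: MochizukiEtTh2009, Prop 2.4 p.38] -/
theorem map_GtpYdduu_subgroupOf_eq_of_prop24_YN
    (hP24 : ∀ γ : C.Huu ≃ₜ* C.Huu, ∃ Γ : D.PiTemp ≃ₜ* D.PiTemp,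
      (∀ h : C.Huu, (Γ h : D.PiTemp) = γ h) ∧ (D.GtpYN 2).map Γ.toMulEquiv.toMonoidHom = D.GtpYN 2)
    (γ : C.Huu ≃ₜ* C.Huu) :
    (C.GtpYdduu.subgroupOf C.Huu).map γ.toMulEquiv.toMonoidHom = C.GtpYdduu.subgroupOf C.Huu := by
  refine C.map_GtpYdduu_subgroupOf_eq_of_prop24 (fun φ => ?_) γ
  obtain ⟨Γ, hΓ, h2⟩ := hP24 φ
  refine ⟨Γ, hΓ, ?_⟩
  rw [Thm16Sub.GtpYdd_eq_GtpYN_two]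
  exact h2

/-! ### Uniqueness of the extension (temp-slimness of `Π^tp_X`, abc-iut-L2-t7's lemma) -/

/-- **The extension of `γ` to `Π^tp_X` is unique** ("induces": any two topological automorphisms of `Π^tp_X`
agreeing on the open subgroup `Π^tp_{X̲̲}` coincide), granted temp-slimness of `Π^tp_X` ([SemiAnbd] Ex. 3.10,
binder `hslim`, gap G-w4d021-3); abc-iut-L2-t7's `IsSlimGroup.continuousMulEquiv_eq_of_eqOn`.
[cite: MochizukiEtTh2009, Prop 2.4 p.38] -/
theorem prop24_extension_unique (hslim : IsSlimGroup D.PiTemp) (γ : C.Huu ≃ₜ* C.Huu) (Γ Γ' : D.PiTemp ≃ₜ* D.PiTemp)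
    (hΓ : ∀ h : C.Huu, (Γ h : D.PiTemp) = γ h) (hΓ' : ∀ h : C.Huu, (Γ' h : D.PiTemp) = γ h) : Γ = Γ' :=
  hslim.continuousMulEquiv_eq_of_eqOn C.isOpen_Huu Γ Γ' fun x hx => by
    rw [hΓ ⟨x, hx⟩, hΓ' ⟨x, hx⟩]

/-- Hence, under `hslim`, the binder `hP24` upgrades to UNIQUE existence of the extension.
[cite: MochizukiEtTh2009, Prop 2.4 p.38] -/
theorem existsUnique_extension_of_prop24 (hslim : IsSlimGroup D.PiTemp)
    (hP24 : ∀ γ : C.Huu ≃ₜ* C.Huu, ∃ Γ : D.PiTemp ≃ₜ* D.PiTemp,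
      (∀ h : C.Huu, (Γ h : D.PiTemp) = γ h) ∧ D.GtpYdd.map Γ.toMulEquiv.toMonoidHom = D.GtpYdd)
    (γ : C.Huu ≃ₜ* C.Huu) :
    ∃! Γ : D.PiTemp ≃ₜ* D.PiTemp, ∀ h : C.Huu, (Γ h : D.PiTemp) = γ h := by
  obtain ⟨Γ, hΓ, -⟩ := hP24 γ
  exact ⟨Γ, hΓ, fun Γ' hΓ' => C.prop24_extension_unique hslim γ Γ' Γ hΓ' hΓ⟩

/-! ### The `Y̲̲`-clause from the `Ÿ̲̲`-clause (squares), for automorphisms of `Π^tp_{X̲̲}` -/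

/-- An element of `Π^tp_{X̲̲}` whose square lies in `Π^tp_Y` lies in `Π^tp_Y` (`Π^tp_X/Π^tp_Y ↪ Z` is
torsion-free). [cite: MochizukiEtTh2009, §1 p.12] -/
theorem mem_GtpY_of_mul_self_mem {x : D.PiTemp} (h : x * x ∈ D.GtpY) : x ∈ D.GtpY := by
  change D.toZ x = 1
  have h2 : D.toZ (x * x) = 1 := h
  rw [map_mul] at h2
  have h3 : (2 : ℕ) • Multiplicative.toAdd (D.toZ x) = 0 := by
    rw [two_nsmul, ← toAdd_mul, h2, toAdd_one]
  rcases smul_eq_zero.mp h3 with h | h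
  · exact absurd h two_ne_zero
  · exact toAdd_eq_zero.mp h

/-- `[Π^tp_{Y̲̲} : Π^tp_{Ÿ̲̲}] = 2` forces squares of `Π^tp_{Y̲̲}` into `Π^tp_{Ÿ̲̲}` (abc-iut-L2-t8's
`relIndex_GtpYdd_inf`). [cite: MochizukiEtTh2009, Def 2.7 p.41] -/
theorem mul_self_mem_GtpYdd_of_mem (hS : D.Sec2Hyps) {y : D.PiTemp} (hyH : y ∈ C.Huu) (hyY : y ∈ D.GtpY) :
    y * y ∈ D.GtpYdd := by
  have hidx : (D.GtpYdd.subgroupOf (C.Huu ⊓ D.GtpY)).index = 2 := C.relIndex_GtpYdd_inf hS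
  have hmem := Subgroup.mul_self_mem_of_index_two hidx ⟨y, Subgroup.mem_inf.mpr ⟨hyH, hyY⟩⟩
  exact Subgroup.mem_subgroupOf.mp hmem

/-- **`Ÿ̲̲`-clause ⇒ `Y̲̲`-clause** (abc-iut-w4-d034's squares argument at the model): a topological automorphism
of `Π^tp_{X̲̲}` stabilising `Π^tp_{Ÿ̲̲}` stabilises `Π^tp_{Y̲̲}`. PROVED (under `Sec2Hyps`, i.e. `K = K̈`).
[cite: MochizukiEtTh2009, Prop 2.4 p.38] -/
theorem map_GtpY_subgroupOf_Huu_eq_of_map_GtpYdduu (hS : D.Sec2Hyps) (γ : C.Huu ≃ₜ* C.Huu)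
    (hdd : ∀ φ : C.Huu ≃ₜ* C.Huu,
      (C.GtpYdduu.subgroupOf C.Huu).map φ.toMulEquiv.toMonoidHom = C.GtpYdduu.subgroupOf C.Huu) :
    (D.GtpY.subgroupOf C.Huu).map γ.toMulEquiv.toMonoidHom = D.GtpY.subgroupOf C.Huu := by
  refine Subgroup.map_eq_of_forall_map_le _ (fun φ => ?_) γ
  rintro _ ⟨x, hx, rfl⟩
  have hx : (x : D.PiTemp) ∈ D.GtpY := Subgroup.mem_subgroupOf.mp hx
  rw [Subgroup.mem_subgroupOf]
  -- `x² ∈ Π^tp_{Ÿ̲̲}`, hence `φ(x)² = φ(x²) ∈ Π^tp_{Ÿ̲̲} ⊆ Π^tp_Y`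
  have hx2 : x * x ∈ C.GtpYdduu.subgroupOf C.Huu := by
    rw [Subgroup.mem_subgroupOf]
    exact Subgroup.mem_inf.mpr ⟨C.mul_self_mem_GtpYdd_of_mem hS x.2 hx, (x * x).2⟩
  have hφx2 : φ x * φ x ∈ C.GtpYdduu.subgroupOf C.Huu := by
    rw [← map_mul, ← hdd φ]
    exact ⟨x * x, hx2, rfl⟩
  rw [Subgroup.mem_subgroupOf] at hφx2
  exact mem_GtpY_of_mul_self_mem (D.GtpYdd_le_GtpY (Subgroup.mem_inf.mp hφx2).1)

/-- **Prop. 2.4 (i) at the model ⇒ both clauses the cone consumes**: under `hP24`, every topological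
automorphism of `Π^tp_{X̲̲}` stabilises `Π^tp_{Ÿ̲̲}` AND `Π^tp_{Y̲̲}` (the pair that [IUTchII] Prop. 2.1 reconstructs
"from `Π^tp_{X̲̲_v}`"). [cite: MochizukiEtTh2009, Prop 2.4 p.38] -/
theorem map_GtpY_GtpYdd_subgroupOf_Huu_eq_of_prop24 (hS : D.Sec2Hyps)
    (hP24 : ∀ γ : C.Huu ≃ₜ* C.Huu, ∃ Γ : D.PiTemp ≃ₜ* D.PiTemp,
      (∀ h : C.Huu, (Γ h : D.PiTemp) = γ h) ∧ D.GtpYdd.map Γ.toMulEquiv.toMonoidHom = D.GtpYdd)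
    (γ : C.Huu ≃ₜ* C.Huu) :
    (D.GtpY.subgroupOf C.Huu).map γ.toMulEquiv.toMonoidHom = D.GtpY.subgroupOf C.Huu ∧
      (D.GtpYdd.subgroupOf C.Huu).map γ.toMulEquiv.toMonoidHom = D.GtpYdd.subgroupOf C.Huu := by
  have hdd := C.map_GtpYdduu_subgroupOf_eq_of_prop24 hP24
  refine ⟨C.map_GtpY_subgroupOf_Huu_eq_of_map_GtpYdduu hS γ hdd, ?_⟩
  have h := hdd γ
  rw [Subgroup.inf_subgroupOf_right] at h
  exact h

end EtaleThetaData.DoubleUnderline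

end ThetaSetting

end Literature.AnabelianGeometry.EtaleTheta

end
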